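import Summits.QuantumAdvantage.QuantumAdvantage.Theorems.WbwThesis.Negative.GuessingBound
import Literature.Computability.Complexity.PolyTimeCountable
import Mathlib.Analysis.SpecificLimits.Normed

/-!
# `WbwThesis` (stmt-QuantumAdvantage-2238) — III: with (Q) dropped the statement is a theorem (diagonal answers)

Sequel of `LoadBearing.lean` (I) and `GuessingBound.lean` (II); same provenance (refuter work file
`Summits/QuantumAdvantage/QuantumAdvantage/Cruxes/WbwThesis/Disproof.lean`, cycle 1). Sorry-free; no Theses
decl is asserted positively: the theorem proved is the (Q)-LESS VARIANT of X (stated inline), showing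
that clause (Q) is the entire content of the crux. Sequel: `NonUniform.lean` (IV, uniformity dropped).

* X without (Q), `∃ gen ∈ FP, ans, (∃ p, |ans s| = p(|gen s|)) ∧ ClauseC gen ans` — HOLDS
  (`wbwThesisWithoutQ_holds`): `gen = id`, `ans s = bad id |s|` with `bad gen n ∈ {0,1}ⁿ` chosen by
  averaging (`exists_good_answer`; disjointness of equal-length prefix events, `sum_succ_le_one`) against
  the first `n` PPT run maps (`runEnum`, from the tree's `countable_setOf_polyTimeComputable`,
  Arora–Barak 2009 §1.4) with every coin count `< 2^{⌊n/2⌋}` (`levelFamily`); a PPT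
  `A = (ρᵢ, coinLen ≤ p)` lies in the level-`n` family for all large `n` (`eventually_coinBudget_lt`), so
  its average success against `bad gen n` is `< εₙ = (n·2^{⌊n/2⌋}+1)/2ⁿ` (`bad_spec`), and `εₙ` is
  negligible (`eps_superpolynomialDecay`). Everything is stated for an arbitrary length-preserving
  instance map `gen` (`clauseC_diagAns`), reused in IV with `gen₀ s = 0^{|s|}`.
* Moral for planners/ideators: classical average-case hardness of polynomial-length unique answers is
  available for free (non-constructively); only the demand that ONE uniform quantum family outputs these
  very answers on every seed makes X a statement about computation. Any mutant of X whose quantum clause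
  does not pin `ans` down is trivial for this reason.
-/

set_option linter.dupNamespace false

namespace Summit.QuantumAdvantage.QuantumAdvantage.Theorems.WbwThesis.Negative

open Literature.Computability.Cryptography Literature.Computability.Complexity
open _root_.Computability Filter Asymptotics

section Diagonal

/-- `|1ⁿ| = n`. [folklore] -/
theorem length_unaryEncodeNat' (n : ℕ) : (unaryEncodeNat n).length = n := by
  induction n with
  | zero => rfl
  | succ n ih => simp [unaryEncodeNat, ih]

/-- The set of run maps of PPT algorithms (polynomial time on the pair presentation `⟨x, r⟩`).
[cite: AroraBarak2009, Def. 7.1] -/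
def pptRuns : Set (List Bool → List Bool → List Bool) :=
  {ρ | PolyTimeComputable (fun w : List Bool × List Bool => boolPair w.1 w.2) (id : List Bool → List Bool)
    (Function.uncurry ρ)}

/-- There are countably many PPT run maps (tree: `countable_setOf_polyTimeComputable`, "machines as
strings"). [cite: AroraBarak2009, §1.4] -/
theorem pptRuns_countable : pptRuns.Countable := by
  have h := countable_setOf_polyTimeComputable (α := List Bool × List Bool) (β := List Bool)
    (fun w : List Bool × List Bool => boolPair w.1 w.2) (eb := (id : List Bool → List Bool))
    Function.injective_id
  exact Set.MapsTo.countable_of_injOn (f := Function.uncurry) (fun ρ hρ => hρ)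
    (Function.uncurry_injective.injOn) h

/-- The coin-echo run map is PPT, so `pptRuns` is nonempty. [folklore] -/
theorem pptRuns_nonempty : pptRuns.Nonempty :=
  ⟨(guess Polynomial.X).run, (guess_isPPT Polynomial.X).1⟩

/-- A fixed enumeration `ρ₀, ρ₁, …` of all PPT run maps. [cite: AroraBarak2009, §1.4] -/
noncomputable def runEnum : ℕ → (List Bool → List Bool → List Bool) :=
  (pptRuns_countable.exists_eq_range pptRuns_nonempty).choose

/-- `pptRuns` is the range of the fixed enumeration `runEnum`. [folklore] -/
theorem pptRuns_eq_range_runEnum : pptRuns = Set.range runEnum :=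
  (pptRuns_countable.exists_eq_range pptRuns_nonempty).choose_spec

/-- Level-`n` success of a run map `ρ` with `c` coins against the candidate answer `a`, for the
instance map `gen`: `E_{s ∈ {0,1}ⁿ} Pr_{r ∈ {0,1}^c}[a ⊑ ρ(⟨1ⁿ, gen s⟩, r)]`. [folklore] -/
noncomputable def succ (gen : List Bool → List Bool) (ρ : List Bool → List Bool → List Bool) (c n : ℕ)
    (a : List Bool) : ℝ :=
  uniformAvg n fun s => uniformProb c {r | a <+: ρ (boolPair (unaryEncodeNat n) (gen s)) r}

/-- Successes are nonnegative. [folklore] -/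
theorem succ_nonneg (gen : List Bool → List Bool) (ρ : List Bool → List Bool → List Bool) (c n : ℕ)
    (a : List Bool) : 0 ≤ succ gen ρ c n a :=
  uniformAvg_nonneg fun _ => uniformProb_nonneg _ _

/-- `uniformProb` as a normalised sum of indicators (any decidability instance). [folklore] -/
theorem uniformProb_eq_sum_ite (m : ℕ) (E : Set (List Bool)) [DecidablePred (· ∈ E)] :
    uniformProb m E = (∑ r : List.Vector Bool m, if r.toList ∈ E then (1 : ℝ) else 0) / 2 ^ m := by
  classical
  unfold uniformProb
  rw [Finset.sum_boole]
  congr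

/-- **Disjoint prefixes**: for a fixed map `f` of the coins, the events "`f r` has prefix `a`",
`a ∈ {0,1}ⁿ`, are pairwise disjoint, so their probabilities sum to at most `1`. [folklore] -/
theorem sum_uniformProb_prefix_le_one (c n : ℕ) (f : List Bool → List Bool) :
    ∑ a : List.Vector Bool n, uniformProb c {r | a.toList <+: f r} ≤ 1 := by
  classical
  simp only [uniformProb_eq_sum_ite, Set.mem_setOf_eq]
  rw [← Finset.sum_div, div_le_one (by positivity), Finset.sum_comm]
  calc ∑ r : List.Vector Bool c, ∑ a : List.Vector Bool n, (if a.toList <+: f r.toList then (1 : ℝ) else 0)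
      ≤ ∑ _r : List.Vector Bool c, (1 : ℝ) := Finset.sum_le_sum fun r _ => by
        rw [Finset.sum_boole, Nat.cast_le_one]
        refine Finset.card_le_one.2 fun a ha b hb => ?_
        simp only [Finset.mem_filter, Finset.mem_univ, true_and] at ha hb
        exact List.Vector.eq _ _ ((List.prefix_of_prefix_length_le ha hb (by simp)).eq_of_length (by simp))
    _ = 2 ^ c := by simp [card_vector]

/-- Summed over all candidate answers of length `n`, level-`n` successes total at most `1`.
[folklore] -/
theorem sum_succ_le_one (gen : List Bool → List Bool) (ρ : List Bool → List Bool → List Bool) (c n : ℕ) :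
    ∑ a : List.Vector Bool n, succ gen ρ c n a.toList ≤ 1 := by
  simp only [succ, uniformAvg]
  rw [← Finset.sum_div, Finset.sum_comm, div_le_one (by positivity)]
  calc ∑ x : List.Vector Bool n, ∑ a : List.Vector Bool n,
        uniformProb c {r | a.toList <+: ρ (boolPair (unaryEncodeNat n) (gen x.toList)) r}
      ≤ ∑ _x : List.Vector Bool n, (1 : ℝ) :=
        Finset.sum_le_sum fun x _ => sum_uniformProb_prefix_le_one c n _
    _ = 2 ^ n := by simp [card_vector]

/-- **Selection by averaging**: against fewer than `2ⁿ ε` (run map, coin count) pairs some answer of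
length `n` keeps every success below `ε`. [folklore] -/
theorem exists_good_answer (gen : List Bool → List Bool) {ι : Type} (J : Finset ι)
    (ρ : ι → List Bool → List Bool → List Bool) (c : ι → ℕ) (n : ℕ) {ε : ℝ}
    (hJ : (J.card : ℝ) < 2 ^ n * ε) :
    ∃ a : List.Vector Bool n, ∀ j ∈ J, succ gen (ρ j) (c j) n a.toList < ε := by
  by_contra h
  simp only [not_exists, not_forall, not_lt] at h
  have h1 : (2 : ℝ) ^ n * ε ≤ ∑ a : List.Vector Bool n, ∑ j ∈ J, succ gen (ρ j) (c j) n a.toList := by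
    calc (2 : ℝ) ^ n * ε = ∑ _a : List.Vector Bool n, ε := by simp [card_vector]
      _ ≤ _ := Finset.sum_le_sum fun a _ => by
          obtain ⟨j, hj, hle⟩ := h a
          exact hle.trans (Finset.single_le_sum (fun j _ => succ_nonneg _ _ _ _ _) hj)
  have h2 : ∑ a : List.Vector Bool n, ∑ j ∈ J, succ gen (ρ j) (c j) n a.toList ≤ J.card := by
    rw [Finset.sum_comm]
    calc ∑ j ∈ J, ∑ a : List.Vector Bool n, succ gen (ρ j) (c j) n a.toList ≤ ∑ _j ∈ J, (1 : ℝ) :=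
          Finset.sum_le_sum fun j _ => sum_succ_le_one _ _ _ _
      _ = J.card := by simp
  linarith

/-- The level-`n` family: the first `n` PPT run maps with every coin count below `2^{⌊n/2⌋}`. [folklore] -/
noncomputable def levelFamily (n : ℕ) : Finset (ℕ × ℕ) := Finset.range n ×ˢ Finset.range (2 ^ (n / 2))

/-- The level-`n` threshold `εₙ = (n·2^{⌊n/2⌋} + 1)/2ⁿ`. [folklore] -/
noncomputable def eps (n : ℕ) : ℝ := ((n * 2 ^ (n / 2) + 1 : ℕ) : ℝ) / 2 ^ n

/-- The level-`n` family has fewer than `2ⁿ εₙ` members (by one). [folklore] -/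
theorem card_levelFamily_lt (n : ℕ) : ((levelFamily n).card : ℝ) < 2 ^ n * eps n := by
  unfold levelFamily eps
  rw [Finset.card_product, Finset.card_range, Finset.card_range, mul_div_cancel₀ _ (by positivity)]
  exact_mod_cast Nat.lt_succ_self _

/-- **The diagonal answer** of length `n` (for the instance map `gen`): below `εₙ` against the whole
level-`n` family. [folklore] -/
noncomputable def bad (gen : List Bool → List Bool) (n : ℕ) : List.Vector Bool n :=
  (exists_good_answer gen (levelFamily n) (fun j => runEnum j.1) (fun j => j.2) n
    (card_levelFamily_lt n)).choose

/-- The defining property of the diagonal answer. [folklore] -/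
theorem bad_spec (gen : List Bool → List Bool) (n : ℕ) :
    ∀ j ∈ levelFamily n, succ gen (runEnum j.1) j.2 n (bad gen n).toList < eps n :=
  (exists_good_answer gen (levelFamily n) (fun j => runEnum j.1) (fun j => j.2) n
    (card_levelFamily_lt n)).choose_spec

/-- `p(m)/2^m → 0` superpolynomially for an `ℕ`-polynomial `p` (twin of the tree's
`superpolynomialDecay_natPoly_div_two_pow`). [folklore] -/
theorem superpolynomialDecay_natPoly_div_two_pow' (P : Polynomial ℕ) :
    SuperpolynomialDecay atTop (fun n : ℕ => (n : ℝ)) (fun n => ((P.eval n : ℕ) : ℝ) / 2 ^ n) := by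
  have h0 : SuperpolynomialDecay atTop (fun n : ℕ => (n : ℝ)) (fun n => ((1 : ℝ) / 2) ^ n) := by
    intro m
    exact tendsto_pow_const_mul_const_pow_of_abs_lt_one m (r := (1 : ℝ) / 2)
      (by rw [abs_of_pos (by norm_num)]; norm_num)
  refine (h0.polynomial_mul (P.map (Nat.castRingHom ℝ))).congr fun n => ?_
  rw [Polynomial.eval_map, Polynomial.eval₂_at_natCast, one_div_pow]
  simp only [eq_natCast, Nat.cast_id]
  ring

/-- `⌊n/2⌋ → ∞`. [folklore] -/
theorem tendsto_half : Tendsto (fun n : ℕ => n / 2) atTop atTop :=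
  Filter.tendsto_atTop_atTop.2 fun b => ⟨2 * b, fun n hn => by omega⟩

/-- **`εₙ` is negligible**: `n^k εₙ ≤ (2m+2)^{k+1}/2^m` with `m = ⌊n/2⌋`. [folklore] -/
theorem eps_superpolynomialDecay : SuperpolynomialDecay atTop (fun n : ℕ => (n : ℝ)) eps := by
  intro k
  have hG := (superpolynomialDecay_natPoly_div_two_pow' ((2 * Polynomial.X + 2) ^ (k + 1)) 0).comp
    tendsto_half
  simp only [pow_zero, one_mul] at hG
  refine squeeze_zero (fun n => by unfold eps; positivity) (fun n => ?_) hG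
  have hn : n ≤ 2 * (n / 2) + 1 := by omega
  have hsub : n / 2 ≤ n - n / 2 := by omega
  simp only [Function.comp_apply, Polynomial.eval_pow, Polynomial.eval_add, Polynomial.eval_mul,
    Polynomial.eval_ofNat, Polynomial.eval_X, eps]
  rw [mul_div_assoc', div_le_div_iff₀ (by positivity) (by positivity)]
  have h1 : (n : ℝ) ^ k * ((n * 2 ^ (n / 2) + 1 : ℕ) : ℝ) ≤ (((2 * (n / 2) + 2) ^ (k + 1) : ℕ) : ℝ) * 2 ^ (n / 2) := by
    have : n ^ k * (n * 2 ^ (n / 2) + 1) ≤ (2 * (n / 2) + 2) ^ (k + 1) * 2 ^ (n / 2) := by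
      have h3 : n * 2 ^ (n / 2) + 1 ≤ (2 * (n / 2) + 2) * 2 ^ (n / 2) := by
        have := Nat.one_le_two_pow (n := n / 2); nlinarith
      calc n ^ k * (n * 2 ^ (n / 2) + 1) ≤ (2 * (n / 2) + 2) ^ k * ((2 * (n / 2) + 2) * 2 ^ (n / 2)) :=
            Nat.mul_le_mul (Nat.pow_le_pow_left (by omega) k) h3
        _ = (2 * (n / 2) + 2) ^ (k + 1) * 2 ^ (n / 2) := by ring
    exact_mod_cast this
  have h2 : (2 : ℝ) ^ (n / 2) * 2 ^ (n / 2) ≤ 2 ^ n := by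
    rw [← pow_add]; exact pow_le_pow_right₀ (by norm_num) (by omega)
  calc (n : ℝ) ^ k * ((n * 2 ^ (n / 2) + 1 : ℕ) : ℝ) * 2 ^ (n / 2)
      ≤ (((2 * (n / 2) + 2) ^ (k + 1) : ℕ) : ℝ) * 2 ^ (n / 2) * 2 ^ (n / 2) :=
        mul_le_mul_of_nonneg_right h1 (by positivity)
    _ ≤ (((2 * (n / 2) + 2) ^ (k + 1) : ℕ) : ℝ) * 2 ^ n := by
        rw [mul_assoc]; exact mul_le_mul_of_nonneg_left h2 (by positivity)

/-- A polynomial coin budget on instances of length `3n+2` is eventually below the level-`n` coin cap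
`2^{⌊n/2⌋}`. [folklore] -/
theorem eventually_coinBudget_lt (p : Polynomial ℕ) : ∀ᶠ n : ℕ in atTop, p.eval (3 * n + 2) < 2 ^ (n / 2) := by
  have hq := (superpolynomialDecay_natPoly_div_two_pow' (p.comp (6 * Polynomial.X + 5)) 0).comp tendsto_half
  simp only [pow_zero, one_mul] at hq
  have hev := hq.eventually (gt_mem_nhds one_pos)
  refine hev.mono fun n hn => ?_
  simp only [Function.comp_apply, Polynomial.eval_comp, Polynomial.eval_add, Polynomial.eval_mul,
    Polynomial.eval_ofNat, Polynomial.eval_X] at hn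
  rw [div_lt_one (by positivity)] at hn
  have h1 : p.eval (3 * n + 2) ≤ p.eval (6 * (n / 2) + 5) := eval_mono_nat p (by omega)
  have h2 : ((p.eval (6 * (n / 2) + 5) : ℕ) : ℝ) < (2 : ℝ) ^ (n / 2) := hn
  have h3 : p.eval (6 * (n / 2) + 5) < 2 ^ (n / 2) := by exact_mod_cast h2
  exact h1.trans_lt h3

/-- The diagonal answer map for the instance map `gen`: `ans s = bad gen |s|` (a function of the
length only). [folklore] -/
noncomputable def diagAns (gen : List Bool → List Bool) (s : List Bool) : List Bool := (bad gen s.length).toList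

/-- **Level-`n` success of a PPT algorithm against `diagAns gen` is its `succ` at
`(run, coinLen (3n+2))`**, for a length-preserving `gen`. [folklore] -/
theorem uniformAvg_pr_eq_succ {gen : List Bool → List Bool} (hlen : ∀ s, (gen s).length = s.length)
    (A : RandAlg (List Bool) (List Bool)) (n : ℕ) :
    uniformAvg n (fun s => A.pr id (boolPair (unaryEncodeNat n) (gen s)) {y | diagAns gen s <+: y}) =
      succ gen A.run (A.coinLen (3 * n + 2)) n (bad gen n).toList := by
  unfold succ uniformAvg
  congr 1
  refine Finset.sum_congr rfl fun x _ => ?_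
  show A.pr id (boolPair (unaryEncodeNat n) (gen x.toList)) {y | diagAns gen x.toList <+: y} =
    uniformProb (A.coinLen (3 * n + 2))
      {r | (bad gen n).toList <+: A.run (boolPair (unaryEncodeNat n) (gen x.toList)) r}
  rw [pr_eq_uniformProb']
  have hlen' : (id (boolPair (unaryEncodeNat n) (gen x.toList))).length = 3 * n + 2 := by
    simp only [id, length_boolPair, length_unaryEncodeNat', hlen, List.Vector.toList_length]; ring
  rw [hlen']
  have hbad : ∀ m, m = n → (bad gen m).toList = (bad gen n).toList := by rintro m rfl; rfl
  simp only [Set.mem_setOf_eq, diagAns, hbad _ (List.Vector.toList_length x)]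

/-- **Clause (C) holds for `(gen, diagAns gen)`** whenever `gen` preserves lengths: a PPT `A` has run
map `ρᵢ` and coin budget `≤ p`; for `n > i` with `p(3n+2) < 2^{⌊n/2⌋}` the pair `(i, coinLen (3n+2))`
lies in the level-`n` family, so `A`'s success is `< εₙ`, negligible. [folklore] -/
theorem clauseC_diagAns {gen : List Bool → List Bool} (hlen : ∀ s, (gen s).length = s.length) :
    ClauseC gen (diagAns gen) := by
  intro A hA
  obtain ⟨hrun, p, hp⟩ := hA
  have hmem : A.run ∈ pptRuns := hrun
  rw [pptRuns_eq_range_runEnum] at hmem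
  obtain ⟨i, hi⟩ := hmem
  have hev : ∀ᶠ n : ℕ in atTop, uniformAvg n (fun s => A.pr id (boolPair (unaryEncodeNat n) (gen s))
      {y | diagAns gen s <+: y}) < eps n := by
    filter_upwards [eventually_gt_atTop i, eventually_coinBudget_lt p] with n hin hcoin
    rw [uniformAvg_pr_eq_succ hlen]
    have hj : (i, A.coinLen (3 * n + 2)) ∈ levelFamily n := by
      simp only [levelFamily, Finset.mem_product, Finset.mem_range]
      exact ⟨hin, (hp _).trans_lt hcoin⟩
    have := bad_spec gen n _ hj
    rwa [hi] at this
  refine eps_superpolynomialDecay.trans_eventually_abs_le (hev.mono fun n hn => ?_)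
  simp only [Function.comp_apply]
  rw [abs_of_nonneg (uniformAvg_nonneg fun _ => RandAlg.pr_nonneg _ _ _ _),
    abs_of_nonneg (by unfold eps; positivity)]
  exact hn.le

/-- **X with clause (Q) DROPPED is a theorem** (`gen = id`, `p = X`, `ans = diagAns id`): a poly-time
generator and answers of polynomial length that every PPT algorithm finds with negligible probability on
average exist unconditionally. So clause (Q) carries ALL the content of X: classical average-case
hardness of polynomial-length unique answers is available for free (non-constructively, Kolmogorov
style), and only the demand that ONE uniform quantum family finds these very answers makes X a
statement about computation. Any mutant of X whose quantum clause does not pin `ans` down is trivial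
for this reason. [folklore] -/
theorem wbwThesisWithoutQ_holds :
    ∃ (gen ans : List Bool → List Bool), PolyTimeComputable id id gen ∧
      (∃ p : Polynomial ℕ, ∀ s, (ans s).length = p.eval (gen s).length) ∧ ClauseC gen ans :=
  ⟨id, diagAns id, PolyTimeComputable.id _, ⟨Polynomial.X, fun s => by simp [diagAns]⟩,
    clauseC_diagAns fun _ => rfl⟩

end Diagonal

end Summit.QuantumAdvantage.QuantumAdvantage.Theorems.WbwThesis.Negative
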